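import Mathlib
import HarnessLib
import HarnessLib.Audit
import Summits.NavierStokesRegularity.Statement
import Literature.Analysis.FluidPDE.Tao2016AveragedNS.LocalCascadeSolutions
import Literature.Analysis.FluidPDE.Tao2016AveragedNS.RestartedCascadeFlows
import Literature.Analysis.FluidPDE.Tao2016AveragedNS.ShiftSetCascadeFlows
import Summits.NavierStokesRegularity.NavierStokesRegularity.Theorems.TaoLadderRungTwoFlatPulseDefs
import Summits.NavierStokesRegularity.NavierStokesRegularity.Theorems.TaoLadderRungTwoFlatGaugeCaptureDefs
import Summits.NavierStokesRegularity.NavierStokesRegularity.Theorems.TaoLadderRungTwoFlatMirrorTableDefs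
import Summits.NavierStokesRegularity.NavierStokesRegularity.Theorems.BarrierStepRungThreeRestartGlue
import HarnessLib.Audit.Status.Attr

/-!
Route: TaoLadderRungTwoFlat

# Route TaoLadderRungTwoFlat — Two-way nearest-neighbour (S-flat) tables of FIXED spread blow up at
every small scale ratio via the mirror-seeded Toda solitary wave (TAO-LADDER rung M₂^(S♭), lattice
level)

RUNG-LEAF ROUTE (D-0061; leaf = TAO-LADDER rung M₂^(S♭) «M-two on S-flat» AT THE LATTICE LEVEL of
cell harvest/h2-tao-ladder = this route's own `Target` item = the cell's `TargetM2Flat` (LADDER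
§23.3 / §25.4, inventory edge M₂ —(−(L-S-1way))→ M₂^(S♭), ruling R-21 ADOPTED by referee c34; leaf
label TL-M2Flat to be minted AFTER birth; MODEL LATTICE ODEs ONLY — nothing here is a statement
about the Navier–Stokes equations or Clay (A)–(D)). Target (M₂^(S♭)-latt): for some C ≥ 1 and ALL
sufficiently small ε₀ > 0 there are a mode count m, a symmetric cancelling C-comparable table α
supported on the TWO-WAY nearest-neighbour shift set S♭ = S ∪ {(1,1,0),(1,0,1),(0,1,1)} (Tao's
one-way S plus the three «backscatter» classes that the Euler bilinear form forces ON between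
adjacent shells and Tao's (4.1) switches OFF) and a one-shell datum X₀ such that NO global
finite-energy pseudo-solution in the S♭ format exists (`NoGlobalCascadeOn shiftSetFlat`: Lemma 4.1's
package (4.4), (4.5), (4.9), (4.10) kept verbatim, the one-way conclusion (4.11) dropped because
energy may now move one shell down). It suffices to show X = K_A♭ ∧ K_B♭: K_A♭ =
`FlatGapCertificatesV2` (for every small ε₀ some S♭-table of spread ≤ C carries version-2 gap
certificates `GapData₂On shiftSetFlat …` with a thin tail, `TailThin`) and K_B♭ =
`GappedFrontRobustV2Flat` (the universally quantified perturbation theorem: S♭ gap certificates +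
thin tail ⇒ a robust front `FrontExistsOn ∧ RobustStepOn`); the three supports port rungs M₂/M₃'s
PROVED restart chain (stmt-…-20424/20425/20426) to the S♭ format. The K_A/K_B item FORMAT is the
cell's v2 format (shared K_B₂ = stmt-NavierStokesRegularity-22114 on S; here its S♭ transpose).
Lean:
`Summit.NavierStokesRegularity.NavierStokesRegularity.Theses.TaoLadderRungTwoFlat.FlatGapCertificatesV2
∧
Summit.NavierStokesRegularity.NavierStokesRegularity.Theses.TaoLadderRungTwoFlat.GappedFrontRobustV2Flat`

## Assembly
Pure logic, PROVED in glue.lean (`closes`, kernel-checked against the S♭ module text in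
sflat/route/Scratch.lean: rc 0 · 0 errors · 0 sorries; = route TaoLadderRungTwo's v2 `closes` with
every S-notion replaced by its S♭ twin and the mode count m threaded through): from K_A♭ take C,
ε_s; for each ε₀ ∈ (0, ε_s] obtain m, σ, i₀, α, X₀, the gap data and the thin tail; K_B♭ (at R := C)
gives η, env, (front), (step) for P := ballDesc Z w r; the base clause holds because the datum lies
in Z (`GapData₂On.toGapDataOn`, `GapDataOn.datum_mem_ball`, signs from `GapDataOn.signs`);
`DynamicsLocalAtOn shiftSetFlat ε₀ C` follows with Q := epochEnvelope env by restarting at the last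
checkpoint (RestartControlOn; horizon clause = c ≤ (T − t_N)γ), applying (step) and re-reading the
StepTo as a level-(N+1) checkpoint (RestartGlue); LocalDynamicsSufficesAtOn turns it into the
Target's ∃ m α X₀. The deciding theorem concludes the route's OWN Target (class rung); until
TL-M2Flat is minted the route is expected to sit `draft` with glue.conclusion-mismatch exactly like
TaoLadderRungTwoPoly (open-before-mint pattern, LADDER §22.7).

Rationale: WHY THIS LINE. On Tao's one-way topology S every screened fixed-spread table dies as ε₀ → 0 because
the transition pulse sheds an O(ε)·(energy) WAKE per hop that nothing can re-absorb (cell §23/§24: θ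
≥ 0.10 and death below seed ε ≈ 0.77√ε₀ for every table on S tried; rung M₂ = route TaoLadderRungTwo
is predicted FALSE, BP-D), whereas on S♭ the backscatter triad returns to shell n exactly what the
emitter took from it: for the m = 2 «mirror-seeded Toda table» T♭(ε) (Toda block + emitter seed +ε
on (a,a,v)@(0,0,0) + mirror seed −δ on the backscatter class (a,a,v)@(1,1,0), δ = ε) both
first-order loss channels vanish identically by the n ↔ n+1, t ↦ −t symmetry of the Toda
heteroclinic, the one-site datum launches an exact lattice SOLITARY WAVE at λ = 1 (per-site residue
≤ 1e-22), and on the graded lattice λ = 1+ε₀ the wave deforms adiabatically with per-hop loss w =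
c(ε)·ε₀² — survival exponent θ = c(ε)ε₀/2 → 0 at FIXED spread C = 2/ε (kit j285091, sealed
prediction P-T5 scored 20/20; Numbers). The mathematics imported is lattice solitary-wave theory for
FPU/Toda chains — existence by the Friesecke–Wattis/Friesecke–Pego variational and near-sonic
methods [doi:10.1007/BF02101505, doi:10.1088/0951-7715/12/6/311] and asymptotic stability in
exponentially weighted spaces [Mizumachi–Pego doi:10.1088/0951-7715/21/9/011, arXiv:1010.5775 Thm
1.2, arXiv:1709.00948 Cor. 23] — transplanted to a GRADED (couplings λⁿ) two-species chain, where
«asymptotic stability modulo shift» becomes the contraction clause of `GapData₂On` and the adiabatic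
loss law becomes `TailThin` + ratio floor (1+ε₀)^(−θ₀); Tao 2016 §§5–6 [Tao2016AveragedNS,
arXiv:1402.0290] supplies the restart/scale-covariance chain already PROVED in the tree for the S
format. What this line does that no open route does: it is the first de-averaging step in TABLE
TOPOLOGY (restoring the B-forced backscatter classes) rather than in spread
(RungTwo/RungTwoPoly/RungThree all live on S), and it turns the obstruction that kills M₂ (the wake)
into the resource that saves M₂^(S♭) (the cancelling mirror channel); the m = 1 slice of the same
class — the mixed Katz–Pavlović + Obukhov scalar dyadic models [arXiv:1406.2423] — is on the REGULAR
side in print (Barriers), so the witness is necessarily multi-species and gated.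

RANKED CRUXES. #0 Target (target) — M₂^(S♭)-latt (= cell `TargetM2Flat`, LADDER §23.3; leaf label
TL-M2Flat to be minted): there are C ≥ 1 and ε_s ∈ (0,1) such that for every ε₀ ∈ (0, ε_s] some mode
count m, some table α ∈ InTableClassOn shiftSetFlat C (symmetric, cancelling, supported on S♭ within
nearest-neighbour separations, max |α| = 1, every non-zero |α| ≥ 1/C) and some one-shell datum X₀
have NoGlobalCascadeOn shiftSetFlat ε₀ α X₀ (no global pseudo-solution obeying (4.4), (4.5), (4.9),
(4.10); (4.11) NOT imposed). Independent of rung M₂ (dropping (4.11) enlarges the solution set; the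
typed arrow is only `NoGlobalCascadeOn.noGlobalCascade`, S♭-format ⇒ S-format for the SAME table).
(why it might fail: Wake-freeness on S♭ is codimension two (P-T8): only the exactly mirrored seed δ
= ε cancels the O(ε) wake, and below the screened range ε₀ ≥ 1.5e-4 a secular detuning or the
one-off DOWNWARD pulse (≈ 0.3ε² of the energy, free to move once (4.11) is gone) may still kill
every fixed-spread table.) [Tao2016AveragedNS, arXiv:1402.0290, arXiv:1406.2423, kit:j285091,
cell:harvest-h2-tao-ladder-theory-1/numT21/MIRROR-SEED-finding.md]
#2 FlatGapCertificatesV2 (crux) — K_A♭ (deciding): there are C ≥ 1 and ε_s ∈ (0,1) such that for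
every ε₀ ∈ (0, ε_s] some m, clock shift σ, mode i₀, table α ∈ InTableClassOn shiftSetFlat C,
one-shell datum X₀ with X₀ i₀ ≠ 0, reference set Z, weight w, radius r, contraction ρ, exponents θ₀
< θ ≤ 1/2, clocks c₀ < c and tail envelope env₀ form version-2 gap data in the S♭ format,
`GapData₂On shiftSetFlat σ ε₀ i₀ α X₀ Z w r ρ θ₀ θ c₀ c env₀` (datum ∈ Z; exact defect-free S♭-flows
from the r-ball around Z step one shell up within clock window [c₀+σ, c] with amplitude ratio ≥
(1+ε₀)^(−θ₀) into the shrunken ρr-ball, with step slack `StepSlackOn`), AND the weight has a thin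
tail `TailThin ε₀ w r` (∀ ϑ > 0, eventually (1+ε₀)^(5(k+2)/2)·r·w(k+1) ≤ ϑ·w(k)²; condition T1 of
referee c35: TailThin is a CONJUNCT here and a HYPOTHESIS of K_B♭). INTENDED WITNESS: m = 2, the
mirror-seeded Toda table T♭(1/2) (spread C = 4), Z = the graded solitary wave's one-hop orbit
segment, Gaussian weights w_k = C_w·2^(k²/2+bk), b ≥ 1/2 (condition T2), θ₀ = c(ε)ε₀/2 + margin < θ
:= 1/2. [difficulty: XL] (why it might fail: Screened only for 1.5e-4 ≤ ε₀ ≤ 1e-2 (floating point):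
the mirror cancellation may drift secularly along the graded cascade (θ₀ ↑ 1/2 below that range), or
GapData₂On's contraction/TailThin clauses may be violated by the wave's one-off downward pulse,
absent on S.) [Tao2016AveragedNS, arXiv:1402.0290, doi:10.1007/BF02101505,
doi:10.1088/0951-7715/12/6/311, doi:10.1088/0951-7715/21/9/011, arXiv:1010.5775, arXiv:1709.00948,
kit:j285091, cell:harvest-h2-tao-ladder-theory-1/numT21/MIRROR-SEED-finding.md]
#3 GappedFrontRobustV2Flat (crux) — K_B♭ (the cell's shared K_B₂ = stmt-NavierStokesRegularity-22114
TRANSPOSED to the S♭ format; universally quantified, no witness shared with K_A♭): for every m, R,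
σ, ε₀ > 0, table α ∈ InTableClassOn shiftSetFlat R, datum (i₀, X₀), reference set Z, weight w and
reals/envelope forming `GapData₂On shiftSetFlat σ ε₀ i₀ α X₀ Z w r ρ θ₀ θ c₀ c env₀`, IF the tail is
thin (`TailThin ε₀ w r`) THEN there are a margin η > 0 and an epoch envelope env such that, with P
:= ballDesc Z w r, (front) `FrontExistsOn shiftSetFlat ε₀ θ c η α P env` (from every P-state with
slack ≤ η·slackWeight an S♭ pseudo-flow with defect (η, η) exists up to clock c) and (step)
`RobustStepOn shiftSetFlat ε₀ θ c η i₀ α P env` (every such pseudo-flow steps one shell up within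
clock c with ratio ≥ (1+ε₀)^(−θ) back into P, slack renormalised by the epoch envelope). FrontExists
is kept as part of the item (referee c33: no split). [difficulty: L] (why it might fail: Without
(4.11) a defect BELOW the front is no longer frozen: far-field control rests on (4.5) + TailThin +
the contraction clause only, and if the backscatter channel lets an O(η) defect behind the wave
re-amplify and climb, K_B♭ is false as typed (repair: a TameBehind-type clause on P).)
[Tao2016AveragedNS, arXiv:1402.0290, doi:10.1088/0951-7715/21/9/011, arXiv:1709.00948]
#9 RestartControlOn (support) — Port of the PROVED support RestartControl
(stmt-NavierStokesRegularity-20424, Theorems/TaoLadderRungThreeRestartControl.lean) to the S♭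
format: Tao's scale covariance as bookkeeping — for θ ≤ 1/2, η > 0, c ≥ 0, X₀ i₀ ≠ 0, K₁, K₂ ≥ 0
there is N₀ such that for n₀ ≥ N₀, along every local S♭ pseudo-solution `CascadeODESolutionOnShift
shiftSetFlat T ε₀ α K₁ K₂ n₀ X₀ X E` and every run of checkpoints with t_N < T, the family restarted
at checkpoint (N, t_N, e_N) is a `PseudoFlowOnShift shiftSetFlat ((T − t_N)γ) ε₀ α η η …` (γ =
e_N(1+ε₀)^(5N/2)) from the rescaled checkpoint state with slack `restartSlack` bounded by
η·slackWeight. The tree proof never uses (4.11) (noLow), so the port is routine. [difficulty: M]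
[Tao2016AveragedNS, arXiv:1402.0290, tree:Theorems.TaoLadderRungThreeRestartControl]
#9 RestartGlue (support) — Definitional bookkeeping, VERBATIM the tree item
stmt-NavierStokesRegularity-20425 (PROVED, Theorems/TaoLadderRungThreeRestartGlue.lean; table- and
shift-set-free, so it is shared as is): a `StepTo` of the flow restarted at checkpoint (N, t_N, e_N)
is a level-(N+1) `EpochCheckpoints` of the original family with t_(N+1) = t_N + τ₁/γ and e_(N+1) =
a·e_N. [difficulty: provable-now] [Tao2016AveragedNS, arXiv:1402.0290,
tree:Theorems.TaoLadderRungThreeRestartGlue]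
#9 LocalDynamicsSufficesAtOn (support) — Port of the PROVED support LocalDynamicsSufficesAt
(stmt-NavierStokesRegularity-20426, Theorems/TaoLadderRungThreeLocalDynamicsSufficesAt.lean) to the
S♭ format: for ε₀ > 0 and R ≥ 1, `DynamicsLocalAtOn shiftSetFlat ε₀ R` (some m, table in
InTableClassOn shiftSetFlat R, datum, description P and envelope Q with the robust checkpoint
induction) ⇒ ∃ m α X₀ with InTableClassOn shiftSetFlat R α ∧ NoGlobalCascadeOn shiftSetFlat ε₀ α X₀
— restrict a global S♭ pseudo-solution to [0, T_* + 1] (`CascadeODESolutionFromOn.restrict`), run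
the ℤ-induction, contradict (4.5). The tree proof uses only (4.5) and the clock/ratio fields, never
(4.11). [difficulty: M] [Tao2016AveragedNS, arXiv:1402.0290,
tree:Theorems.TaoLadderRungThreeLocalDynamicsSufficesAt]

TWO-LAYER PLAN. Foreseen glued split of the decider (nothing filed now; LADDER §23.7(a)):
FlatGapCertificatesV2 ⇐ MirrorSolitaryWave → GradedAdiabaticWake → FlatGapCertificatesV2, where
MirrorSolitaryWave (ε₀-free, λ = 1: for the mirror-seeded Toda table T♭(ε), ε ≤ ε_an, the one-site
datum lies on the stable set of an exact lattice solitary wave — an advance–delay ODE for the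
profile — with a spectral gap transverse to the shift/energy directions in the exponentially
weighted norm; Friesecke–Pego / Mizumachi–Pego / Herrmann–Matthies transplanted to the two-species
chain) and GradedAdiabaticWake (for λ = 1+ε₀, ε₀ ≤ ε_s, the graded one-hop map is a
C¹-O(ε₀)-perturbation of the homogeneous one in the weighted norm, so the gap persists with ρ = 1 −
κε, the per-hop loss is ≤ c(ε)ε₀² + o(ε₀²) (θ₀ := c(ε)ε₀ < θ := 1/2), TailThin with Gaussian weights
from the quadratic driving two shells ahead, and the one-off downward pulse stays inside the (4.5)
budget) — glue M-sized (assemble GapData₂On from the two). K_B♭, if it needs depth: the S proof's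
(front)/(step) lemmas with `TameBehind` replaced by a two-sided tameness clause — filed only after
K_B₂ (stmt-22114) has a registered skeleton on S (p1 g9 architecture, HOME
rung2/kb-p1g9/KB2-ARCHITECTURE-p1g9.md).

KILL CRITERIA. refuted:FlatGapCertificatesV2 with a SUBSTANTIVE witness — a theorem that for every C
≥ 1 there are arbitrarily small ε₀ at which no S♭-table in InTableClassOn shiftSetFlat C admits
version-2 gap data with a thin tail (engine: an ε₀-uniform lower bound on the per-hop loss of every
fixed-spread two-way table, i.e. wake-cancellation cannot be exact beyond first order uniformly in
the hop count; or a proof that the downward pulse must grow) — closes the route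
`refuted:FlatGapCertificatesV2` and records M₂^(S♭) FALSE next to M₂ (ladder news either way: then
BP-D is not a one-wayness artefact). refuted:GappedFrontRobustV2Flat SUBSTANTIVE (backscatter
re-amplifies defects behind the front for every description P of ballDesc type) forces a pivot to a
two-sided description (new K_B♭ item with a TameBehind-type clause, same K_A♭). A MISSTATED-class
refutation of either (a clause of GapData₂On / StepSlackOn / TailThin that the mirror solitary wave
violates while still driving blow-up) is repaired by the v2→v3 pattern (new item <Decl>R +
re-certified glue, refuted decl kept as a negative edge). Proved elsewhere that moots it: none —
TaoLadderRungTwo.Target (M₂ on S) does NOT imply this Target (independent leaves, LADDER §23.3 A7).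

NOT DECOMPOSED YET. Deliberately NOT items at open: the solitary wave itself (existence/uniqueness
of the T♭(ε) profile as a Lean object, its orbit segment Z, the weights w and the constants σ, ρ,
θ₀, c₀, c, env₀, ε_an, ε_s), the split of Two-layer plan, the choice between an all-analytic
perturbative proof (small seed ε, KdV/Toda limit) and interval certification of finitely many (ε₀,
ε)-boxes, local well-posedness of the exact S♭ lattice in the weighted space (part of (front)), and
the S♭ ports of the K_B machinery (StepSlack/TailStep lemmas p565789 & co. are stated on S; their S♭
twins are prover-level `--supports` lemmas, never items). The single-(ε₀, ε) certificate at (1/100,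
1/2) is the BC5 rung (plan-only stub in the birth skeleton), not an item.

CHEAPEST FALSIFIER. RUN BY THE CELL BEFORE FILING (kit j285091, 52 inviscid runs × 405 hops, sealed
prediction P-T5 e14eb392305dc110 written before submission; MODEL lattice, floating point, nothing
certified): does the mirror-seeded table T♭(ε), δ = ε, survive at FIXED spread as ε₀ ↓ 0? ε ∈ {0.05,
0.2, 0.5, 1, 2} × ε₀ ∈ {1e-2, 2.5e-3, 6.25e-4, 1.5625e-4}: 20/20 SURVIVE, every run settles (std ≤
2e-7) to a per-hop loss w with d log w / d log ε₀ = 2.012/2.006/2.00/2.00/2.00 and c(ε) := w/ε₀² =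
0.072/0.445/1.175/2.075/3.16 constant in ε₀ to ≤ 5 % ⇒ θ = c(ε)ε₀/2 ≤ 0.0104 for ε ≤ 1 — versus θ ≥
0.10 and death below ε ≈ 0.77√ε₀ for EVERY table on S the cell tried. VERDICT: the falsifier did NOT
fire. Next cheapest killers (refuter): (i) detune δ = (1 ± 0.1)ε and halve ε₀ twice more — a
survival window around δ = ε shrinking faster than the certificate's ρ-ball kills K_A♭ for the FIXED
table (P-T8: codimension two); (ii) the m = 1 slice is the mixed KP+Obukhov dyadic model,
regular-side in print (Barriers) — a strategy not using m ≥ 2 is suspect; «M₂^(S♭) EASIER than M₂»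
is a SCREEN statement about the m = 2 mirror table, not a theorem.

NUMBERS. MIRROR-SEED RUNS (cell theory-1 g12, kit j285091; HOME
harvest-h2-tao-ladder-theory-1/numT21/MIRROR-SEED-finding.md; MODEL lattice, floating point). Table
T♭(ε) (m = 2 species a = carrier, v = bond; entries on S♭ classes, translation-reduced): Toda block
α_(vva,(0,0,0)) = −1, α_(vva,(0,0,1)) = +1, α_(avv,(0,0,0)) = α_(vav,(0,0,0)) = +1/2,
α_(avv,(1,0,0)) = α_(vav,(0,1,0)) = −1/2; emitter seed α_(aav,(0,0,0)) = +ε, α_(ava,(0,0,0)) =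
α_(vaa,(0,0,0)) = −ε/2; mirror seed (backscatter class) α_(aav,(1,1,0)) = −δ, α_(ava,(1,0,1)) =
α_(vaa,(0,1,1)) = +δ/2, δ = ε; spread C = 2/ε for ε ≤ 1 (ε = 1/2 ⇒ C = 4). Lattice: a_n' = −λⁿv_n² +
λ^(n−1)v_(n−1)² − ελⁿa_nv_n + ελ^(n−1)a_nv_(n−1) (+ mirror terms), v_n' = λⁿ[v_n(a_n − a_(n+1)) +
ε(a_n² − a_(n+1)²)], λ = 1+ε₀. Per-hop loss w = c(ε)ε₀², c(ε) = 0.072 (ε = 0.05), 0.445 (0.2), 1.175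
(0.5), 2.075 (1), 3.16 (2); survival exponent θ = c(ε)ε₀/2: at (ε₀, ε) = (1/100, 1/2): θ = 0.0059 ≪
1/2; at λ = 1 the one-site datum is an exact solitary wave to residue ≤ 1e-22 (ε ∈ {0.05, 0.5, 1,
2}); two-sided chain (40 shells below the datum): same law plus ONE downward solitary pulse carrying
7e-4/0.012/0.057/0.135/0.24 of the energy (≈ 0.3ε² for small ε), not growing with hops; detuning δ =
(1 ± 0.1)ε at ε = 1 kills only at the smallest ε₀ screened (P-T8: wake-freeness is codimension two,
not rigid). Comparison on S (route TaoLadderRungTwo Numbers): T4 Neimark–Sacker loss of the DSS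
front at ε₀ ≈ 0.0185; seeded Toda on S needs ε = K√ε₀, K < 0.78 (route TaoLadderRungTwoPoly, q =
1/2). S♭ has 7 translation classes (card_shiftSetFlat, `decide`); S has 4.

DEFINITION REQUESTS. ONE, FILED: defn-shiftSetFlat (kind definition, topic
Literature/Analysis/FluidPDE/Tao2016AveragedNS, filed 2026-08-27T21:16Z by this seat) = land the S♭
vocabulary module `Literature.Analysis.FluidPDE.Tao2016AveragedNS.ShiftSetCascadeFlows` VERBATIM
from HOME harvest-h2-tao-ladder-theory-1/sflat/ShiftSetCascadeFlows.lean (sha16 d8615b073b32a9d2,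
562 lines, `lean check` rc 0 · 0 warnings · 0 sorries, standard axioms; namespace
`Literature.Analysis.FluidPDE.TaoCascade`): shiftSetFlat (+ mem_shiftSetFlat_iff,
shiftSet_subset_shiftSetFlat, card_shiftSetFlat = 7), quadTermOn 𝕊 (quadTermOn shiftSet = quadTerm,
rfl), IsSymmetricCoeffOn / IsCancellingCoeffOn / IsComparableCoeffOn 𝕊 R / InTableClassOn (+
`_shiftSet_iff` bridges to the tree's S notions), CascadeODESolutionFromOn 𝕊 and
CascadeODESolutionOnShift 𝕊 T (the S structures without (4.11)), NoGlobalCascadeOn (+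
`.noGlobalCascade`), PseudoFlowOnShift, DynamicsLocalAtOn (∃ m inside), FrontExistsOn, RobustStepOn,
GapDataOn (+ .signs, .datum_mem_ball), StepSlackOn, GapData₂On (+ .toGapDataOn). Every item of this
route elaborates against that module text (sflat/route/Scratch.lean rc 0). Cite facts wanted: none
(the FPU/Toda solitary-wave papers are method sources, not hypotheses). Operator ask
(HOME/OPS-REQUESTS.md): MINT TL-M2Flat :=
`Summit.NavierStokesRegularity.NavierStokesRegularity.Theses.TaoLadderRungTwoFlat.Target` as an
admissible rung closer after birth, then `ledger route edit
route-NavierStokesRegularity-TaoLadderRungTwoFlat --closes-target <minted label>`.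

Novelty: Searches (2026-08-27, this seat, both corpora, source-labelled): `lit search --hybrid "dyadic model
Euler blow-up Obukhov Katz-Pavlovic mixed" -n 8` (8 docs: [corpus:paper:arxiv-1506.07480],
[corpus:paper:arxiv-2407.06776] Córdoba–Martínez-Zoroa hypodissipative NS blow-up,
[corpus:paper:arxiv-2501.07377] shell-model DSS, books off-topic); `lit search "Jeong Li dyadic
models Euler blow-up" -n 8` (8 HELD papers: arxiv-2605.13827, arxiv-2209.10203 (survey),
arxiv-1406.2423, arxiv-1705.01456, arxiv-2008.03747, arxiv-2009.07952, arxiv-2102.03498,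
arxiv-2107.04073; remote: doi:10.1007/s00220-015-2295-y, doi:10.1090/s0002-9947-04-03532-9
Katz–Pavlović); `lit vsearch "finite time blow-up for a dyadic shell model … combining the
Katz-Pavlovic forward transfer and the Obukhov coupling …" -k 8` (book noise: frisch1995, bohr1998,
ditlevsen2010 shell models); `lit galaxy search "Obukhov model|dyadic model|Katz-Pavlovic" --star
all -n 10` (20 rows, all off-topic: no hits); `lit galaxy search "Toda lattice|solitary wave|FPU
lattice" --star pdf -n 8` (8 rows off-topic: no hits); plus route TaoLadderRungTwoPoly's searches of
2026-08-27 on Toda/FPUT stability (Mizumachi–Pego, Herrmann–Matthies, Benes–Hoffman–Wayne HELD).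
PRESEARCH (C5, mixed KP+Obukhov scalar members): presearch: «blow-up for two-way (KP+Obukhov) scalar
dyadic models» → [corpus:paper:arxiv-1406.2423 p.3 L19–L21, L62–L72; p.4 Thm 2] Jeong–Li: the model
ȧ_j = α(λʲa²_(j−1) − λ^(j+1)a_ja_(j+1)) + β(λʲa_(j−1)a_j − λ^(j+1)a²_(j+1))  [refs: 10.1007/s00220-015-2295-y, 10.1090/s0002-9947-04-03532-9, 10.1088/0951-7715/21/9/011, 1402.0290, paper:arxiv-1506.07480, paper:arxiv-2407.06776, paper:arxiv-2501.07377, arxiv-2605.13827, arxiv-2209.10203, arxiv-1406.2423, arxiv-1705.01456, arxiv-2008.03747, arxiv-2009.07952, arxiv-2102.03498, arxiv-2107.04073, doi:10.1007/s00220-015-2295-y, doi:10.1090/s0002-9947-04-03532-9, paper:arxiv-1406.2423,]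

Barriers (technique_class: cascade-blowup, lattice-soliton-front, backscatter, restart): - technique_class: cascade-blowup, lattice-soliton-front, backscatter, restart
- Literature.Barriers.NavierStokesRegularity.DyadicCascadeRegularity: the nearest CONSTRUCTION-side
barrier and it bites the m = 1 slice head-on — the scalar nearest-neighbour cascade with
3-D-strength dissipation is globally regular for non-negative data (Barbato–Morandin–Romito 2011 Thm
1, in-tree `DyadicInvariantRegion`), and the scalar TWO-WAY members of E(S♭) are the mixed
KP+Obukhov models, regular-side in print (A5 annotation: Obukhov inviscid regular [MR2180809;
corpus:paper:arxiv-1406.2423 p.3, corpus:paper:arxiv-2605.13827 p.3 L29–L30], mixed blow-up only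
hypodissipative γ < 1/3 [arXiv:1406.2423 Thm 2]); EVASION: the witness is m = 2 and GATED (the Toda
bond holds the energy on a shell for a clock ~ 1/ε before release) and the barrier theorems quantify
over scalar positive cascades only — the crux never passes through an m = 1 statement; the barrier
is exactly why «M₂^(S♭) easier than M₂» is recorded as a SCREEN statement about the mirror table,
not as a structural claim about two-way classes.
- Literature.Barriers.NavierStokesRegularity.TaoAveragedBlowup: consistent, and outside its step
test (`abstractTwoStepFails`, AveragedEquationStepTest.lean constrain REGULARITY proofs for true NS
blind to averaging); this route proves BLOW-UP for a model lattice class and claims nothing about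
NS. Provenance caveat recorded, not claimed: whether an S♭-table is realisable as an averaged Euler
bilinea

sub-problem: NavierStokesRegularity · status: draft · opened planner-harvest-h2-tao-ladder-theory-1-g14-0 2026-08-27T21:49:34Z · rev 1 · ledger route-NavierStokesRegularity-TaoLadderRungTwoFlat
GENERATED by the gate from the ledger (D-0016/17). Provers cite these decls: `theorem foo : Summit.NavierStokesRegularity.NavierStokesRegularity.Theses.TaoLadderRungTwoFlat.<Decl> := …` in Summits/NavierStokesRegularity/NavierStokesRegularity/Theorems/<Name>.lean.
-/

namespace Summit.NavierStokesRegularity.NavierStokesRegularity.Theses.TaoLadderRungTwoFlat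

open scoped BigOperators Topology Manifold Classical MeasureTheory ProbabilityTheory Matrix InnerProductSpace ComplexConjugate ContinuousMap
open Filter Set Function TopologicalSpace MeasureTheory

attribute [summit_statement] _root_.NavierStokesRegularity

open Literature.NS

/-- item stmt-NavierStokesRegularity-22987 · crux · rank 2 · SPLIT (gen 1) into MirrorSolitaryWave, GradedAdiabaticWake + glue FlatGapOfMirrorLayer · direct attempts still welcome (low priority) · by planner
why it might fail: Screened only for 1.5e-4 ≤ ε₀ ≤ 1e-2 (floating point): the mirror cancellation may drift secularly along the graded cascade (θ₀ ↑ 1/2 below that range), or GapData₂On's contraction/TailThin clauses may be violated by the wave's one-off downward pulse, absent on S.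
sources: Tao2016AveragedNS, arXiv:1402.0290, doi:10.1007/BF02101505, doi:10.1088/0951-7715/12/6/311, doi:10.1088/0951-7715/21/9/011, arXiv:1010.5775
[crux] K_A♭ (deciding): there are C ≥ 1 and ε_s ∈ (0,1) such that for every ε₀ ∈ (0, ε_s] some m,
clock shift σ, mode i₀, table α ∈ InTableClassOn shiftSetFlat C, one-shell datum X₀ with X₀ i₀ ≠ 0,
reference set Z, weight w, radius r, contraction ρ, exponents θ₀ < θ ≤ 1/2, clocks c₀ < c and tail
envelope env₀ form version-2 gap data in the S♭ format, `GapData₂On shiftSetFlat σ ε₀ i₀ α X₀ Z w r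
ρ θ₀ θ c₀ c env₀` (datum ∈ Z; exact defect-free S♭-flows from the r-ball around Z step one shell up
within clock window [c₀+σ, c] with amplitude ratio ≥ (1+ε₀)^(−θ₀) into the shrunken ρr-ball, with
step slack `StepSlackOn`), AND the weight has a thin tail `TailThin ε₀ w r` (∀ ϑ > 0, eventually
(1+ε₀)^(5(k+2)/2)·r·w(k+1) ≤ ϑ·w(k)²; condition T1 of referee c35: TailThin is a CONJUNCT here and a
HYPOTHESIS of K_B♭). INTENDED WITNESS: m = 2, the mirror-seeded Toda table T♭(1/2) (spread C = 4), Z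
= the graded solitary wave's one-hop orbit segment, Gaussian weights w_k = C_w·2^(k²/2+bk), b ≥ 1/2
(condition T2), θ₀ = c(ε)ε₀/2 + margin < θ := 1/2. [difficulty: XL] -/
@[route_item "route-NavierStokesRegularity-TaoLadderRungTwoFlat", crux (experiment := "instrument: kit jobs cited as sources kit:j285091") (source := "ledger wanted_by.sources on stmt-NavierStokesRegularity-22987, 2026-09-01")]
def FlatGapCertificatesV2 : Prop :=
  ∃ C : ℝ, 1 ≤ C ∧ ∃ εs : ℝ, 0 < εs ∧ εs < 1 ∧ ∀ ε₀ : ℝ, 0 < ε₀ → ε₀ ≤ εs → ∃ (m : ℕ) (σ : ℝ) (i₀ : Fin m) (α : Fin m → Fin m → Fin m → ℤ × ℤ × ℤ → ℝ) (X₀ : Fin m → ℝ) (Z : Set (Fin m → ℤ → ℝ)) (w : ℤ → ℝ) (r ρ θ₀ θ c₀ c : ℝ) (env₀ : ℤ → ℝ), Literature.Analysis.FluidPDE.TaoCascade.InTableClassOn Literature.Analysis.FluidPDE.TaoCascade.shiftSetFlat C α ∧ X₀ i₀ ≠ 0 ∧ Literature.Analysis.FluidPDE.TaoCascade.GapData₂On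 Literature.Analysis.FluidPDE.TaoCascade.shiftSetFlat σ ε₀ i₀ α X₀ Z w r ρ θ₀ θ c₀ c env₀ ∧ Literature.Analysis.FluidPDE.TaoCascade.TailThin ε₀ w r

-- parent: FlatGapCertificatesV2 · child (gen 1)
/--     item stmt-NavierStokesRegularity-23908 · crux · rank 201 · open
    parent: FlatGapCertificatesV2 · by planner
    why it might fail: Krawczyk enclosure of the R-symmetric pulse may not close on a ±12 window; weighted row-sum may exceed 1 in every geometric gauge (float ρ=0.57 at (4,2), transient 1.69); (WG) on half-lines ∀N needs an a-priori tail lemma + the flat junk race 0.92<1.25; β₁=0.121 must certify <1/6.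
    sources: Tao2016AveragedNS, arXiv:1402.0290, doi:10.1088/0951-7715/15/4/317, doi:10.1088/0951-7715/21/9/011, tree:Theorems.TaoLadderRungTwoFlatGaugeCaptureDefs, tree:Theorems.TaoLadderRungTwoFlatPulseDefs
[crux] M1# = the lambda_0 = 1 layer of K_A-flat (child 1 of the two-layer split, SPLIT-T48 = g36
repair of SPLIT-T47): the homogeneous mirror lattice T-flat(1/2) on S-flat carries an R-symmetric
pulse incoming from vacuum (MirrorPulse.IsPulse, IsRSymmetricTraj, vacuum atBot) together with an
EXPLICIT GEOMETRIC gauge omega = geomGauge g b = g^{k+} b^{-k-} (1 < g, 1 < b; certified (4,2)),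
contraction factor rho < 1, projection bound C and hop count N satisfying the linearised N-hop
contraction modulo phase/scale (MirrorPulse.HopContractionWith = the body of p1 g19's
LinearisedHopContraction with the gauge exposed) AND capturing the charged datum x0E3 = (1,2),
observable = carrier, IN THAT GAUGE (MirrorPulse.CapturedInGauge: THE datum solution X, scale kappa
> 0, checkpoints 0 = s0 < s1 < ... with bounded gaps; (H) headroom (1+eta)|X0 i0| <= |X i0 n (s n)|
for n >= 1; (WG) for every K, delta: eventually in N, omega_{i,k}*|X_{i,N+k}(s_N) -
kappa*Phi_{i,k}(0)| <= delta for ALL k >= -K (window and everything ahead); (JB) junk-energy bound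
E(x0E3) < kappa^2*E_{K0}(Phi(0)) + junkThreshold(1/2)*(kappa/tau)^2, junkThreshold(1/2) = 1/6, E =
half sum of squares, finite window K0). Target of ON -/
@[route_item "route-NavierStokesRegularity-TaoLadderRungTwoFlat"]
def MirrorSolitaryWave : Prop :=
  ∃ (τ : ℝ) (Φ : Fin 2 → ℤ → ℝ → ℝ) (g b ρ C : ℝ) (N : ℕ), 1 < g ∧ 1 < b ∧ Summit.NavierStokesRegularity.NavierStokesRegularity.Theorems.MirrorPulse.IsPulse (1 / 2) τ Φ ∧ Summit.NavierStokesRegularity.NavierStokesRegularity.Theorems.MirrorPulse.IsRSymmetricTraj Φ ∧ (∀ (i : Fin 2) (n : ℤ), Filter.Tendsto (Φ i n) Filter.atBot (nhds 0)) ∧ Summit.NavierStokesRegularity.NavierStokesRegularity.Theorems.MirrorPulse.HopContractionWith (1 / 2) τ Φ (Summit.NavierStokesRegularity.NavierStokesRegularity.Theorems.MirrorPulse.geomGauge g b) ρ C N ∧ Summit.NavierStokesRegularity.NavierStokesRegularity.Theorems.MirrorPulse.CapturedInGauge (1 / 2) τ Φ (Summit.NavierStokesRegularity.NavierStokesRegularity.Theorems.MirrorPulse.geomGauge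 g b) Summit.NavierStokesRegularity.NavierStokesRegularity.Theorems.MirrorPulse.datumE3 0 (Summit.NavierStokesRegularity.NavierStokesRegularity.Theorems.MirrorPulse.junkThreshold (1 / 2))

-- parent: FlatGapCertificatesV2 · child (gen 1)
/--     item stmt-NavierStokesRegularity-23909 · crux · rank 202 · open
    parent: FlatGapCertificatesV2 · by planner
    why it might fail: Singular limit: ball radius O(θ₀ε₀³)→0 vs ~log(1/ε₀) contracting hops at launch; gauge surgery g^{k⁺}b^{−k⁻} → format weights near vacuum uniformly in N; the λ₀>1 wake has O(1) total energy, so L8 must use POINTWISE amplitude O(ε₀κ) — an O(ε₀) re-coupling to the front kills StepSlackOn.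
    sources: Tao2016AveragedNS, arXiv:1402.0290, doi:10.1088/0951-7715/12/6/311, doi:10.1088/0951-7715/15/4/317, arXiv:0711.2134, tree:Theorems.TaoLadderRungTwoFlatGaugeCaptureDefs
[crux] The TRANSFER THEOREM (child 2, SPLIT-T48; eps0-uniform analysis, universally quantified; the
only number inside is the interface constant junkThreshold(eps) = 3/(8(1+eps)^2)): for every mirror
table T-flat(eps) (0 < eps <= 1), datum X0 with X0 i0 != 0, pulse (tau, Phi) and geometric gauge
data (g, b, rho, C, N), omega = geomGauge g b, 1 < g, 1 < b, satisfying the lambda_0 = 1 layer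
(IsPulse, IsRSymmetricTraj, vacuum atBot, HopContractionWith, CapturedInGauge with (H) headroom,
(WG) gauge convergence on every half-line k >= -K, (JB) junk energy E(X0) - kappa^2 E_{K0}(Phi) <
junkThreshold(eps)*(kappa/tau)^2) there is eps_s > 0 such that for all 0 < eps0 <= eps_s the table
admits format-v2 gap data with thin tail for X0 (GapData2On shiftSetFlat ... ∧ TailThin). Mechanism
(LADDER §46-§48): renormalised frame (RenormFrame.clockW_mul_quadTermOn: graded lattice =
homogeneous lattice of alpha~(eps0) = T-flat + eps0*T1 + O(eps0^2), T1 R-odd by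
MirrorReversibility.quadTermOn_reflectFam_graded) => persisted relative periodic orbit with N-hop
contraction in the gauge omega, first-order per-hop loss zero; basin entry from (WG) at a finite
checkpoint transported to lambda_0 > 1 by finite- -/
@[route_item "route-NavierStokesRegularity-TaoLadderRungTwoFlat"]
def GradedAdiabaticWake : Prop :=
  ∀ (ε : ℝ) (X₀ : Fin 2 → ℝ) (i₀ : Fin 2) (τ : ℝ) (Φ : Fin 2 → ℤ → ℝ → ℝ) (g b ρ C : ℝ) (N : ℕ), 0 < ε → ε ≤ 1 → X₀ i₀ ≠ 0 → 1 < g → 1 < b → Summit.NavierStokesRegularity.NavierStokesRegularity.Theorems.MirrorPulse.IsPulse ε τ Φ → Summit.NavierStokesRegularity.NavierStokesRegularity.Theorems.MirrorPulse.IsRSymmetricTraj Φ → (∀ (i : Fin 2) (n : ℤ), Filter.Tendsto (Φ i n) Filter.atBot (nhds 0)) → Summit.NavierStokesRegularity.NavierStokesRegularity.Theorems.MirrorPulse.HopContractionWith ε τ Φ (Summit.NavierStokesRegularity.NavierStokesRegularity.Theorems.MirrorPulse.geomGauge g b) ρ C N → Summit.NavierStokesRegularity.NavierStokesRegularity.Theorems.MirrorPulse.CapturedInGauge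 ε τ Φ (Summit.NavierStokesRegularity.NavierStokesRegularity.Theorems.MirrorPulse.geomGauge g b) X₀ i₀ (Summit.NavierStokesRegularity.NavierStokesRegularity.Theorems.MirrorPulse.junkThreshold ε) → ∃ εs : ℝ, 0 < εs ∧ ∀ ε₀ : ℝ, 0 < ε₀ → ε₀ ≤ εs → ∃ (σ : ℝ) (Z : Set (Fin 2 → ℤ → ℝ)) (w : ℤ → ℝ) (r ρ' θ₀ θ c₀ c : ℝ) (env₀ : ℤ → ℝ), Literature.Analysis.FluidPDE.TaoCascade.GapData₂On Literature.Analysis.FluidPDE.TaoCascade.shiftSetFlat σ ε₀ i₀ (Summit.NavierStokesRegularity.NavierStokesRegularity.Theorems.mirrorTable ε ε) X₀ Z w r ρ' θ₀ θ c₀ c env₀ ∧ Literature.Analysis.FluidPDE.TaoCascade.TailThin ε₀ w r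

-- parent: FlatGapCertificatesV2 · glue (gen 1)
/--     item stmt-NavierStokesRegularity-23910 · support · rank 203 · closed · proved by Summit.NavierStokesRegularity.NavierStokesRegularity.Theorems.taoLadderRungTwoFlat_flatGapOfMirrorLayer_proof (prover)
    parent: FlatGapCertificatesV2 · GLUE: children ⟹ parent · by planner
MirrorSolitaryWave → GradedAdiabaticWake → FlatGapCertificatesV2: instantiate the transfer theorem
(child 2) at ε = 1/2, X₀ = MirrorPulse.datumE3 = (1,2), i₀ = 0 (carrier) with child 1's pulse (τ, Φ)
and certified geometric gauge data (g, b, ρ, C, N); C = 4 by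
Theorems.inTableClassOn_mirrorTable_half; εs := min εs (1/2). Proof of record:
numT48/SplitPreview48.lean 55a26067d7d2afb1 / numT49/SplitPreview48T.lean 97f55d6c02a49351, theorem
flatGapCertificatesV2_of_split48 (12 lines, rc 0, 0 sorry). -/
@[route_item "route-NavierStokesRegularity-TaoLadderRungTwoFlat"]
def FlatGapOfMirrorLayer : Prop :=
  MirrorSolitaryWave → GradedAdiabaticWake → FlatGapCertificatesV2

-- `FlatGapOfMirrorLayer` holds: proved by `Summit.NavierStokesRegularity.NavierStokesRegularity.Theorems.taoLadderRungTwoFlat_flatGapOfMirrorLayer_proof` (its module imports this route file, so no `_holds` link can be stated here).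

/-- item stmt-NavierStokesRegularity-22988 · crux · rank 3 · closed · proved by Summit.NavierStokesRegularity.NavierStokesRegularity.Theorems.taoLadderRungTwoFlat_gappedFrontRobustV2Flat_proof (prover) · by planner
why it might fail: Without (4.11) a defect BELOW the front is no longer frozen: far-field control rests on (4.5) + TailThin + the contraction clause only, and if the backscatter channel lets an O(η) defect behind the wave re-amplify and climb, K_B♭ is false as typed (repair: a TameBehind-type clause on P).
sources: Tao2016AveragedNS, arXiv:1402.0290, doi:10.1088/0951-7715/21/9/011, arXiv:1709.00948
[crux] K_B♭ (the cell's shared K_B₂ = stmt-NavierStokesRegularity-22114 TRANSPOSED to the S♭ format;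
universally quantified, no witness shared with K_A♭): for every m, R, σ, ε₀ > 0, table α ∈
InTableClassOn shiftSetFlat R, datum (i₀, X₀), reference set Z, weight w and reals/envelope forming
`GapData₂On shiftSetFlat σ ε₀ i₀ α X₀ Z w r ρ θ₀ θ c₀ c env₀`, IF the tail is thin (`TailThin ε₀ w
r`) THEN there are a margin η > 0 and an epoch envelope env such that, with P := ballDesc Z w r,
(front) `FrontExistsOn shiftSetFlat ε₀ θ c η α P env` (from every P-state with slack ≤ η·slackWeight
an S♭ pseudo-flow with defect (η, η) exists up to clock c) and (step) `RobustStepOn shiftSetFlat ε₀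
θ c η i₀ α P env` (every such pseudo-flow steps one shell up within clock c with ratio ≥ (1+ε₀)^(−θ)
back into P, slack renormalised by the epoch envelope). FrontExists is kept as part of the item
(referee c33: no split). [difficulty: L] -/
@[route_item "route-NavierStokesRegularity-TaoLadderRungTwoFlat", crux]
def GappedFrontRobustV2Flat : Prop :=
  ∀ (m : ℕ) (R σ ε₀ : ℝ) (i₀ : Fin m) (α : Fin m → Fin m → Fin m → ℤ × ℤ × ℤ → ℝ) (X₀ : Fin m → ℝ) (Z : Set (Fin m → ℤ → ℝ)) (w : ℤ → ℝ) (r ρ θ₀ θ c₀ c : ℝ) (env₀ : ℤ → ℝ), Literature.Analysis.FluidPDE.TaoCascade.InTableClassOn Literature.Analysis.FluidPDE.TaoCascade.shiftSetFlat R α → 0 < ε₀ → Literature.Analysis.FluidPDE.TaoCascade.GapData₂On Literature.Analysis.FluidPDE.TaoCascade.shiftSetFlat σ ε₀ i₀ α X₀ Z w r ρ θ₀ θ c₀ c env₀ → Literature.Analysis.FluidPDE.TaoCascade.TailThin ε₀ w r → ∃ (η : ℝ) (env : ℤ → ℝ), 0 < η ∧ Literature.Analysis.FluidPDE.TaoCascade.FrontExistsOn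 Literature.Analysis.FluidPDE.TaoCascade.shiftSetFlat ε₀ θ c η α (Literature.Analysis.FluidPDE.TaoCascade.ballDesc Z w r) env ∧ Literature.Analysis.FluidPDE.TaoCascade.RobustStepOn Literature.Analysis.FluidPDE.TaoCascade.shiftSetFlat ε₀ θ c η i₀ α (Literature.Analysis.FluidPDE.TaoCascade.ballDesc Z w r) env

-- `GappedFrontRobustV2Flat` holds: proved by `Summit.NavierStokesRegularity.NavierStokesRegularity.Theorems.taoLadderRungTwoFlat_gappedFrontRobustV2Flat_proof` (its module imports this route file, so no `_holds` link can be stated here).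

/-- item stmt-NavierStokesRegularity-22986 · aside · rank 0 · open · by planner
why it might fail: Wake-freeness on S♭ is codimension two (P-T8): only the exactly mirrored seed δ = ε cancels the O(ε) wake, and below the screened range ε₀ ≥ 1.5e-4 a secular detuning or the one-off DOWNWARD pulse (≈ 0.3ε² of the energy, free to move once (4.11) is gone) may still kill every fixed-spread table.
sources: Tao2016AveragedNS, arXiv:1402.0290, arXiv:1406.2423, kit:j285091, cell:harvest-h2-tao-ladder-theory-1/numT21/MIRROR-SEED-finding.md
[target] M₂^(S♭)-latt (= cell `TargetM2Flat`, LADDER §23.3; leaf label TL-M2Flat to be minted):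
there are C ≥ 1 and ε_s ∈ (0,1) such that for every ε₀ ∈ (0, ε_s] some mode count m, some table α ∈
InTableClassOn shiftSetFlat C (symmetric, cancelling, supported on S♭ within nearest-neighbour
separations, max |α| = 1, every non-zero |α| ≥ 1/C) and some one-shell datum X₀ have
NoGlobalCascadeOn shiftSetFlat ε₀ α X₀ (no global pseudo-solution obeying (4.4), (4.5), (4.9),
(4.10); (4.11) NOT imposed). Independent of rung M₂ (dropping (4.11) enlarges the solution set; the
typed arrow is only `NoGlobalCascadeOn.noGlobalCascade`, S♭-format ⇒ S-format for the SAME table). -/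
@[route_item "route-NavierStokesRegularity-TaoLadderRungTwoFlat"]
def Target : Prop :=
  ∃ C : ℝ, 1 ≤ C ∧ ∃ εs : ℝ, 0 < εs ∧ εs < 1 ∧ ∀ ε₀ : ℝ, 0 < ε₀ → ε₀ ≤ εs → ∃ (m : ℕ) (α : Fin m → Fin m → Fin m → ℤ × ℤ × ℤ → ℝ) (X₀ : Fin m → ℝ), Literature.Analysis.FluidPDE.TaoCascade.InTableClassOn Literature.Analysis.FluidPDE.TaoCascade.shiftSetFlat C α ∧ Literature.Analysis.FluidPDE.TaoCascade.NoGlobalCascadeOn Literature.Analysis.FluidPDE.TaoCascade.shiftSetFlat ε₀ α X₀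

/-- item stmt-NavierStokesRegularity-22989 · support · rank 9 · closed · proved by Summit.NavierStokesRegularity.NavierStokesRegularity.Theorems.taoLadderRungTwoFlat_restartControlOn_proof (prover) · by planner
sources: Tao2016AveragedNS, arXiv:1402.0290, tree:Theorems.TaoLadderRungThreeRestartControl
[support] Port of the PROVED support RestartControl (stmt-NavierStokesRegularity-20424,
Theorems/TaoLadderRungThreeRestartControl.lean) to the S♭ format: Tao's scale covariance as
bookkeeping — for θ ≤ 1/2, η > 0, c ≥ 0, X₀ i₀ ≠ 0, K₁, K₂ ≥ 0 there is N₀ such that for n₀ ≥ N₀,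
along every local S♭ pseudo-solution `CascadeODESolutionOnShift shiftSetFlat T ε₀ α K₁ K₂ n₀ X₀ X E`
and every run of checkpoints with t_N < T, the family restarted at checkpoint (N, t_N, e_N) is a
`PseudoFlowOnShift shiftSetFlat ((T − t_N)γ) ε₀ α η η …` (γ = e_N(1+ε₀)^(5N/2)) from the rescaled
checkpoint state with slack `restartSlack` bounded by η·slackWeight. The tree proof never uses
(4.11) (noLow), so the port is routine. [difficulty: M] -/
@[route_item "route-NavierStokesRegularity-TaoLadderRungTwoFlat", crux]
def RestartControlOn : Prop :=
  ∀ (m : ℕ) (ε₀ θ c η : ℝ) (i₀ : Fin m) (α : Fin m → Fin m → Fin m → ℤ × ℤ × ℤ → ℝ) (X₀ : Fin m → ℝ) (P : (Fin m → ℤ → ℝ) → (Fin m → ℤ → ℝ) → Prop) (env : ℤ → ℝ) (K₁ K₂ : ℝ), 0 < ε₀ → θ ≤ 1 / 2 → 0 ≤ c → 0 < η → X₀ i₀ ≠ 0 → 0 ≤ K₁ → 0 ≤ K₂ → ∃ N₀ : ℤ, ∀ n₀ : ℤ, N₀ ≤ n₀ → ∀ T : ℝ, 0 < T → ∀ X E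 : Fin m → ℤ → ℝ → ℝ, Literature.Analysis.FluidPDE.TaoCascade.CascadeODESolutionOnShift Literature.Analysis.FluidPDE.TaoCascade.shiftSetFlat T ε₀ α K₁ K₂ n₀ X₀ X E → ∀ N : ℤ, n₀ ≤ N → ∀ t e : ℤ → ℝ, Literature.Analysis.FluidPDE.TaoCascade.EpochCheckpoints ε₀ θ c i₀ n₀ X₀ P (Literature.Analysis.FluidPDE.TaoCascade.epochEnvelope env) N X E t e → t N < T → Literature.Analysis.FluidPDE.TaoCascade.PseudoFlowOnShift Literature.Analysis.FluidPDE.TaoCascade.shiftSetFlat ((T - t N) * (e N * (1 + ε₀) ^ ((5 : ℝ) * N / 2))) ε₀ α η η (fun i k => X i (N + k) (t N) / e N) (fun i k => E i (N + k) (t N) / e N ^ 2) (Literature.Analysis.FluidPDE.TaoCascade.restartSlack ε₀ K₂ N (t N) (e N) E) (Literature.Analysis.FluidPDE.TaoCascade.restartX ε₀ N (t N) (e N) X) (Literature.Analysis.FluidPDE.TaoCascade.restartE ε₀ N (t N) (e N) E) ∧ ∀ i k, 0 ≤ Literature.Analysis.FluidPDE.TaoCascade.restartSlack ε₀ K₂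 N (t N) (e N) E i k ∧ Literature.Analysis.FluidPDE.TaoCascade.restartSlack ε₀ K₂ N (t N) (e N) E i k ≤ η * Literature.Analysis.FluidPDE.TaoCascade.slackWeight ε₀ θ c env (N - n₀).toNat k

-- `RestartControlOn` holds: proved by `Summit.NavierStokesRegularity.NavierStokesRegularity.Theorems.taoLadderRungTwoFlat_restartControlOn_proof` (its module imports this route file, so no `_holds` link can be stated here).

/-- item stmt-NavierStokesRegularity-22990 · support · rank 9 · closed · proved by Summit.NavierStokesRegularity.NavierStokesRegularity.Theorems.barrierStepRungThree_restartGlue_proof (prover) · by planner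
sources: Tao2016AveragedNS, arXiv:1402.0290, tree:Theorems.TaoLadderRungThreeRestartGlue
[support] Definitional bookkeeping, VERBATIM the tree item stmt-NavierStokesRegularity-20425
(PROVED, Theorems/TaoLadderRungThreeRestartGlue.lean; table- and shift-set-free, so it is shared as
is): a `StepTo` of the flow restarted at checkpoint (N, t_N, e_N) is a level-(N+1)
`EpochCheckpoints` of the original family with t_(N+1) = t_N + τ₁/γ and e_(N+1) = a·e_N.
[difficulty: provable-now] -/
@[route_item "route-NavierStokesRegularity-TaoLadderRungTwoFlat", crux]
def RestartGlue : Prop :=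
  ∀ (ε₀ θ c : ℝ) (m : ℕ) (i₀ : Fin m) (n₀ : ℤ) (X₀ : Fin m → ℝ) (P Q : (Fin m → ℤ → ℝ) → (Fin m → ℤ → ℝ) → Prop) (N : ℤ) (X E : Fin m → ℤ → ℝ → ℝ) (t e : ℤ → ℝ) (τ₁ a : ℝ), 0 < ε₀ → n₀ ≤ N → Literature.Analysis.FluidPDE.TaoCascade.EpochCheckpoints ε₀ θ c i₀ n₀ X₀ P Q N X E t e → Literature.Analysis.FluidPDE.TaoCascade.StepTo ε₀ θ c i₀ P Q (Literature.Analysis.FluidPDE.TaoCascade.restartX ε₀ N (t N) (e N) X) (Literature.Analysis.FluidPDE.TaoCascade.restartE ε₀ N (t N) (e N) E) τ₁ a → Literature.Analysis.FluidPDE.TaoCascade.EpochCheckpoints ε₀ θ c i₀ n₀ X₀ P Q (N + 1) X E (Function.update t (N + 1) (t N + τ₁ / (e N * (1 + ε₀) ^ ((5 : ℝ) * N / 2)))) (Function.update e (N + 1) (a * e N))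

/-- `RestartGlue` holds: proved by `Summit.NavierStokesRegularity.NavierStokesRegularity.Theorems.barrierStepRungThree_restartGlue_proof`. -/
theorem RestartGlue_holds : RestartGlue := _root_.Summit.NavierStokesRegularity.NavierStokesRegularity.Theorems.barrierStepRungThree_restartGlue_proof

/-- item stmt-NavierStokesRegularity-22991 · support · rank 9 · closed · proved by Summit.NavierStokesRegularity.NavierStokesRegularity.Theorems.taoLadderRungTwoFlat_localDynamicsSufficesAtOn_proof (prover) · by planner
sources: Tao2016AveragedNS, arXiv:1402.0290, tree:Theorems.TaoLadderRungThreeLocalDynamicsSufficesAt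
[support] Port of the PROVED support LocalDynamicsSufficesAt (stmt-NavierStokesRegularity-20426,
Theorems/TaoLadderRungThreeLocalDynamicsSufficesAt.lean) to the S♭ format: for ε₀ > 0 and R ≥ 1,
`DynamicsLocalAtOn shiftSetFlat ε₀ R` (some m, table in InTableClassOn shiftSetFlat R, datum,
description P and envelope Q with the robust checkpoint induction) ⇒ ∃ m α X₀ with InTableClassOn
shiftSetFlat R α ∧ NoGlobalCascadeOn shiftSetFlat ε₀ α X₀ — restrict a global S♭ pseudo-solution to
[0, T_* + 1] (`CascadeODESolutionFromOn.restrict`), run the ℤ-induction, contradict (4.5). The tree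
proof uses only (4.5) and the clock/ratio fields, never (4.11). [difficulty: M] -/
@[route_item "route-NavierStokesRegularity-TaoLadderRungTwoFlat", crux]
def LocalDynamicsSufficesAtOn : Prop :=
  ∀ ε₀ R : ℝ, 0 < ε₀ → 1 ≤ R → Literature.Analysis.FluidPDE.TaoCascade.DynamicsLocalAtOn Literature.Analysis.FluidPDE.TaoCascade.shiftSetFlat ε₀ R → ∃ (m : ℕ) (α : Fin m → Fin m → Fin m → ℤ × ℤ × ℤ → ℝ) (X₀ : Fin m → ℝ), Literature.Analysis.FluidPDE.TaoCascade.InTableClassOn Literature.Analysis.FluidPDE.TaoCascade.shiftSetFlat R α ∧ Literature.Analysis.FluidPDE.TaoCascade.NoGlobalCascadeOn Literature.Analysis.FluidPDE.TaoCascade.shiftSetFlat ε₀ α X₀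

-- `LocalDynamicsSufficesAtOn` holds: proved by `Summit.NavierStokesRegularity.NavierStokesRegularity.Theorems.taoLadderRungTwoFlat_localDynamicsSufficesAtOn_proof` (its module imports this route file, so no `_holds` link can be stated here).

/-- item stmt-NavierStokesRegularity-22992 · assembly · rank 1 · closed · proved by Summit.NavierStokesRegularity.NavierStokesRegularity.Theorems.taoLadderRungTwoFlat_assembly_proof (prover) · by planner
sources: Tao2016AveragedNS, arXiv:1402.0290
[assembly] FlatGapCertificatesV2 → GappedFrontRobustV2Flat → RestartControlOn → RestartGlue →
LocalDynamicsSufficesAtOn → Target (the rung leaf M₂^(S♭)-latt; NOT the summit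
`NavierStokesRegularity`, which this route does not conclude — class rung, D-0061). -/
@[route_item "route-NavierStokesRegularity-TaoLadderRungTwoFlat"]
def Assembly : Prop :=
  FlatGapCertificatesV2 → GappedFrontRobustV2Flat → RestartControlOn → RestartGlue → LocalDynamicsSufficesAtOn → Target

-- `Assembly` holds: proved by `Summit.NavierStokesRegularity.NavierStokesRegularity.Theorems.taoLadderRungTwoFlat_assembly_proof` (its module imports this route file, so no `_holds` link can be stated here).

/-! D-0027 §2.1 — DECIDING THEOREM (planner-authored via `route open/edit --closes-file`; by planner-harvest-h2-tao-ladder-theory-1-g14-0 2026-08-27T21:49:35Z):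
its hypotheses are this route's items and its conclusion the sub-problem Statement (glue_lint), and it elaborates with this file. -/

/-- The deciding theorem of route TaoLadderRungTwoFlat: K_A♭ → K_B♭ → restart control on S♭ → restart glue → local dynamics suffice on S♭ → Target («M₂^{S♭}», lattice level; MODEL only). -/
@[closes "route-NavierStokesRegularity-TaoLadderRungTwoFlat"] theorem closes (h₁ : FlatGapCertificatesV2) (h₂ : GappedFrontRobustV2Flat) (h₃ : RestartControlOn)
    (h₄ : RestartGlue) (h₅ : LocalDynamicsSufficesAtOn) : Target := by
  obtain ⟨C, hC, εs, hεs₀, hεs₁, hall⟩ := h₁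
  refine ⟨C, hC, εs, hεs₀, hεs₁, fun ε₀ hε₀ hε₀s => ?_⟩
  obtain ⟨m, σ, i₀, α, X₀, Z, w, r, ρ, θ₀, θ, c₀, c, env₀, hα, hX₀, hgap₂, hthin⟩ := hall ε₀ hε₀ hε₀s
  obtain ⟨η, env, hη, -, hstep⟩ := h₂ m C σ ε₀ i₀ α X₀ Z w r ρ θ₀ θ c₀ c env₀ hα hε₀ hgap₂ hthin
  have hgap := Literature.Analysis.FluidPDE.TaoCascade.GapData₂On.toGapDataOn hgap₂
  obtain ⟨-, -, -, hθ₀, hθ₀θ, hθ, hc₀, hc₀c, -⟩ :=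
    Literature.Analysis.FluidPDE.TaoCascade.GapDataOn.signs hgap
  have hball := Literature.Analysis.FluidPDE.TaoCascade.GapDataOn.datum_mem_ball hgap
    (Literature.Analysis.FluidPDE.TaoCascade.datumEnergy i₀ X₀)
  have hc : 0 < c := lt_trans hc₀ hc₀c
  have hdyn : Literature.Analysis.FluidPDE.TaoCascade.DynamicsLocalAtOn Literature.Analysis.FluidPDE.TaoCascade.shiftSetFlat ε₀ C := by
    refine ⟨m, θ, c, i₀, α, X₀, Literature.Analysis.FluidPDE.TaoCascade.ballDesc Z w r,
      Literature.Analysis.FluidPDE.TaoCascade.epochEnvelope env, by linarith, by linarith, hc,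
      hα, hX₀, hball, ?_⟩
    intro K₁ K₂ hK₁ hK₂
    obtain ⟨N₀, hN₀⟩ := h₃ m ε₀ θ c η i₀ α X₀
      (Literature.Analysis.FluidPDE.TaoCascade.ballDesc Z w r) env K₁ K₂ hε₀ hθ hc.le hη hX₀ hK₁ hK₂
    refine ⟨N₀, fun n₀ hn₀ T hT X E hsol N hN t e hcp hhor => ?_⟩
    have heN : 0 < e N := hcp.e_pos N hN le_rfl
    have hpow : 0 < (1 + ε₀) ^ ((5 : ℝ) * N / 2) := Real.rpow_pos_of_pos (by linarith) _
    have hγ : 0 < e N * (1 + ε₀) ^ ((5 : ℝ) * N / 2) := mul_pos heN hpow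
    have hneg : (1 + ε₀) ^ (-(5 : ℝ) * N / 2) = ((1 + ε₀) ^ ((5 : ℝ) * N / 2))⁻¹ := by
      rw [← Real.rpow_neg (by linarith : (0 : ℝ) ≤ 1 + ε₀)]
      congr 1
      ring
    have hcγ : c * (1 + ε₀) ^ (-(5 : ℝ) * N / 2) * (e N)⁻¹ =
        c / (e N * (1 + ε₀) ^ ((5 : ℝ) * N / 2)) := by
      rw [hneg]
      field_simp
    rw [hcγ] at hhor
    have hdiv : 0 < c / (e N * (1 + ε₀) ^ ((5 : ℝ) * N / 2)) := div_pos hc hγ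
    have htN : t N < T := by linarith
    have hτ : c ≤ (T - t N) * (e N * (1 + ε₀) ^ ((5 : ℝ) * N / 2)) := by
      have h2 : c / (e N * (1 + ε₀) ^ ((5 : ℝ) * N / 2)) ≤ T - t N := by linarith
      have h3 := mul_le_mul_of_nonneg_right h2 hγ.le
      rwa [div_mul_cancel₀ c hγ.ne'] at h3
    obtain ⟨hflow, hslack⟩ := hN₀ n₀ hn₀ T hT X E hsol N hN t e hcp htN
    obtain ⟨τ₁, a, hst⟩ :=
      hstep (N - n₀).toNat _ _ _ (hcp.state N hN le_rfl) hslack _ hτ _ _ hflow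
    exact ⟨_, _, h₄ ε₀ θ c m i₀ n₀ X₀ _ _ N X E t e τ₁ a hε₀ hN hcp hst⟩
  exact h₅ ε₀ C hε₀ hC hdyn

end Summit.NavierStokesRegularity.NavierStokesRegularity.Theses.TaoLadderRungTwoFlat
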